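import Literature.AnabelianGeometry.EtaleTheta.Discharge.Sec2Prop24OfCoreExtension
import Literature.AnabelianGeometry.EtaleTheta.Discharge.Sec2Prop26Reduction
import HarnessLib

/-!
# [EtTh] Prop. 2.6 over the interface: the core form SHRINKS to the bare extension (`Ċ̲`, `Ċ̲̲`) resp.
# «extension stabilising `Π^tp_Ċ`» (`Ẋ̲̲`, `Ẋ̲`) (proof-only)

Mochizuki, *The étale theta function and its Frobenioid-theoretic manifestations* [EtTh], Publ. RIMS **45**
(2009), §2, Prop. 2.6, PRIMS PDF p. 40 (printed p. 266) [cite: MochizukiEtTh2009, Prop 2.6 p.40]: «any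
isomorphism of topological groups `Π^tp_{Ẋ̲̲_α} ⥲ Π^tp_{Ẋ̲̲_β}` (resp. `Ẋ̲`; `Ċ̲̲`; `Ċ̲`) induces isomorphisms
compatible with the various natural maps between the respective `Π^tp`'s of `X̲̲` (resp. `X̲`; `C̲̲`; `C̲`) and
`Ċ`»; proof: «entirely similar to the proofs of Propositions 1.8, 2.4» (the `K`-core); Rmk. 2.6.1 p. 40 (the
`Aut_K(−)`'s of the dotted curves are the direct products with `Gal(Ċ/C) ≅ {±1}`); Rmk. 2.1.1 p. 36.
Cell abc-iut, layer L2, cone node EtTh:Prop2.6 (FACT-policy by name, L2-lead R985/R998; abc-iut-w4-d098 gen 8,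
self-named bounded row «P26-CORE-V2»).  SEQUEL of abc-iut-w6-d084's `Sec2Prop26Reduction.lean`
(`prop26_iff_core`: the typed `TemperedCoverData.Prop26` — FACT-LIST F-0610 — is equivalent to its CORE: every
`γ ∈ Aut(Π^tp_Ż)` extends to `Π^tp_C` stabilising `Π^tp_Z` and, for the `X`-members `Ẋ̲̲`, `Ẋ̲` only, `Π^tp_Ċ`)
and the Prop. 2.6 twin of this seat's `Sec2Prop24OfCoreExtension.lean`.  PURE GROUP THEORY over abc-iut-L2-t2's
interface `ThetaCovers.TemperedCoverData` (`ThetaCoversTempered.lean`, DEFS-FROZEN, not edited); no definition, no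
instance, no named fact; abc-iut-L2-t12's dotted normalisers (`Sec2AutKDottedOfOdd`: `N(Π^tp_Ż) = N(Π^tp_Z)` by
`l` odd), abc-iut-L6-t23's `tpPiXu_normal` / `nonempty_autK_tpPiXu_mulEquiv_dihedralGroup` /
`normalizer_tpPiCuu_eq`, abc-iut-L2-d3's `not_le_PiCdot_of_mem_four` and w6-d084's `prop26_of_core` /
`core_of_prop26` / `map_eq_self_of_restricts` are consumed BY NAME.

THE POINT.  The `Z`-conjunct of w6-d084's core is a THEOREM over the interface for all four members, for ANY
topological automorphism `Γ` of `Π^tp_C` stabilising `Π^tp_Ż = Π^tp_Z ∩ Π^tp_Ċ`: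
* **`C̲` from `Ċ̲`, NO hypothesis** (`map_tp_PiCu_eq_of_map_inf_PiCdot_PiCu`): `Γ` stabilises
  `N(Π^tp_{Ċ̲}) = N(Π^tp_{C̲}) = Π^tp_{C̲}` (Rmk. 2.1.1 / L2-t12 `normalizer_tpPiCu_inf_PiCdot_eq`);
* **`C̲̲` from `Ċ̲̲` under `μ_l ⊆ K`** (`map_tp_PiCuu_eq_of_map_inf_PiCdot_PiCuu`): `Γ` stabilises
  `N(Π^tp_{Ċ̲̲}) = Π^tp_{C̲}`; `Γ(Π^tp_{C̲̲})` and `Π^tp_{C̲̲}` are index-`2` overgroups of `Π^tp_{Ċ̲̲}` inside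
  `Π^tp_{C̲} = N(Π^tp_{C̲̲})`, of ODD index `l` there — equal (`Subgroup.eq_of_relIndex_two_of_odd_relIndex`; Rmk. 2.6.1:
  `Aut_K(Ċ̲̲) = μ_l × {±1}` has a unique involution);
* **`X̲̲` from `Ẋ̲̲` under `μ_l ⊆ K`, the printed definition `hΘ` of `Δ̄_Θ`, `l ≠ 1`**
  (`map_tp_PiXuu_eq_of_map_inf_PiCdot_PiXuu`): `Γ` stabilises `N(Π^tp_{Ẋ̲̲}) = Π^tp_{C̲}`, hence the normal core
  `Π^tp_{X̲}` (`Sec2Prop24OfCoreExtension`), and `Γ(Π^tp_{X̲̲})`, `Π^tp_{X̲̲}` are index-`2` overgroups of `Π^tp_{Ẋ̲̲}`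
  inside `Π^tp_{X̲} ≤ N(Π^tp_{X̲̲})`, of odd index `l` there;
* **`X̲` from `Ẋ̲`, `l ≠ 1`, NO further hypothesis** (`map_tp_PiXu_eq_of_map_inf_PiCdot_PiXu`): `Π^tp_{X̲}` is
  the set of `g ∈ Π^tp_C` ALL of whose commutators lie in `Π^tp_{Ẋ̲}` (`mem_tp_PiXu_iff_forall_commutator_mem`) —
  i.e. `Π^tp_{X̲}/Π^tp_{Ẋ̲}` is the CENTRE of `Π^tp_C/Π^tp_{Ẋ̲} ≅ D_l × ℤ/2` — because `Π^tp_C/Π^tp_{X̲} ≅ D_l`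
  (Rmk. 2.6.1, L6-t23) is centreless for `l` odd `≠ 1` (Mathlib `DihedralGroup.center_eq_bot_of_odd_ne_one`) and
  commutators die in the index-`2` quotient `Π^tp_C/Π^tp_Ċ`; such a subgroup is stabilised by every automorphism
  stabilising `Π^tp_{Ẋ̲}` (`Subgroup.map_eq_of_mem_iff_forall_commutator_mem`).
Hence **`prop26_iff_extends`** (`hΘ`, `μ_l ⊆ K`, `l ≠ 1`): the typed `Prop26` ⟺ ⟨every `γ ∈ Aut(Π^tp_{Ċ̲})` and every
`γ ∈ Aut(Π^tp_{Ċ̲̲})` EXTENDS to a topological automorphism of `Π^tp_C` (nothing else); every `γ ∈ Aut(Π^tp_{Ẋ̲̲})`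
and every `γ ∈ Aut(Π^tp_{Ẋ̲})` extends to one stabilising `Π^tp_Ċ`⟩.  WHAT PRINT'S HYPOTHESES LEAVE TO PROVE at
a datum where Prop. 2.6 holds: for the `C`-members EXACTLY the `K`-core extension ([Mzk3] Thm. 2.4); for the
`X`-members the extension plus the characteristic nature of the double covering `Ċ → C` (Def. 1.7; the interface
carries `Π^tp_Ċ` as a datum of index `2`, and at the quotient level `Aut(D_l × ℤ/2)` interchanges the two non-`X`
index-`2` overgroups of `Π^tp_{Ẋ̲}`, so the `Ċ`-conjunct is displayed, not derived).  The extension fails at every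
decided semi-synthetic datum of record (abc-iut-f-143 `not_forall_prop26`, abc-iut-f-151
`not_prop26_temperedCoverData_inversionModelκ'`, abc-iut-w6-d084 `not_prop26_of_hatConj`).  HONEST FRAMING:
nothing here asserts that a `TemperedCoverData` satisfying `Prop26` exists, nor anything about genuine tempered
fundamental groups; F-0610 stays a named input where consumed; reduced-to-named-inputs ≠ proved-in-print; typed ≠
proved; no side is taken on [IUTchIII] Cor. 3.12 or on any disputed claim.
-/

namespace Literature.AnabelianGeometry.EtaleTheta

namespace ThetaCovers

universe u

/-! ### Group theory: subgroups cut out by a commutator condition are characteristic relative to the target -/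

section GroupTheory

variable {G : Type*} [Group G]

/-- If `K.map e = K` for a group automorphism `e`, then also `K.map e⁻¹ = K`. [folklore] -/
private theorem map_symm_eq_of_map_eq'' (e : G ≃* G) {K : Subgroup G} (h : K.map e.toMonoidHom = K) :
    K.map e.symm.toMonoidHom = K := by
  conv_lhs => rw [← h]
  have hid : e.symm.toMonoidHom.comp e.toMonoidHom = MonoidHom.id G := by ext x; simp
  rw [Subgroup.map_map, hid, Subgroup.map_id]

/-- **A subgroup cut out by «all commutators lie in `D`» is stabilised by every automorphism stabilising `D`**:
if `K = {g | ∀ h, g h g⁻¹ h⁻¹ ∈ D}` (i.e. `K/…` is the centre of `G` modulo `D` when `D ⊴ G`) and `e(D) = D` for an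
automorphism `e` of `G`, then `e(K) = K`.  (Dot-notation extension into Mathlib's `Subgroup` namespace.)  In
[EtTh] §2: `Π^tp_{X̲}` is recovered from `Π^tp_{Ẋ̲}` (Rmk. 2.6.1). [cite: MochizukiEtTh2009, Rmk 2.6.1 p.40] -/
theorem _root_.Subgroup.map_eq_of_mem_iff_forall_commutator_mem {K D : Subgroup G}
    (hK : ∀ g : G, g ∈ K ↔ ∀ h : G, g * h * g⁻¹ * h⁻¹ ∈ D) (e : G ≃* G) (hD : D.map e.toMonoidHom = D) :
    K.map e.toMonoidHom = K := by
  have key : ∀ f : G ≃* G, D.map f.toMonoidHom = D → K.map f.toMonoidHom ≤ K := by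
    rintro f hf _ ⟨g, hg, rfl⟩
    rw [hK]
    intro h
    have h1 : g * f.symm h * g⁻¹ * (f.symm h)⁻¹ ∈ D := (hK g).mp hg (f.symm h)
    have h2 : f.toMonoidHom (g * f.symm h * g⁻¹ * (f.symm h)⁻¹) ∈ D.map f.toMonoidHom := ⟨_, h1, rfl⟩
    rw [hf] at h2
    simpa [map_mul, map_inv, MulEquiv.apply_symm_apply] using h2
  refine le_antisymm (key e hD) fun k hk => ?_
  exact ⟨e.symm k, key e.symm (map_symm_eq_of_map_eq'' e hD) ⟨k, hk, rfl⟩, e.apply_symm_apply k⟩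

end GroupTheory

namespace TemperedCoverData

variable {l : ℕ} (T : TemperedCoverData.{u} l)

/-! ### Bookkeeping: indices of the dotted members over the undotted ones -/

/-- `Π^tp_{C̲̲} ≤ Π^tp_{C̲}` (a `private` copy of abc-iut-L2's `tp_PiCuu_le_tp_PiCu` of
`Sec2Cor28iiiOuterEndKnitChiCusp.lean`, not imported here). [cite: MochizukiEtTh2009, Def 2.1 p.36] -/
private theorem tp_PiCuu_le_tp_PiCu'' : T.tp T.PiCuu ≤ T.tp T.PiCu :=
  Subgroup.comap_mono (le_sup_left : T.PiCuu ≤ T.PiCu)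

/-- `[Π^tp_Z : Π^tp_Ż] = 2` for the four undotted members (`Ż → Z` is a genuine double covering, `l` odd:
abc-iut-L2-d3's `not_le_PiCdot_of_mem_four`). [cite: MochizukiEtTh2009, Def 2.5 (ii) p.39] -/
theorem relIndex_inf_PiCdot_of_mem_four {Z : Subgroup T.Gtp}
    (hZ : Z ∈ [T.tp T.PiXuu, T.tp T.PiXu, T.tp T.PiCuu, T.tp T.PiCu]) : (Z ⊓ T.PiCdot).relIndex Z = 2 := by
  haveI : T.PiCdot.Normal := Subgroup.normal_of_index_eq_two T.index_PiCdot
  exact relIndex_inf_eq_two_of_not_le T.index_PiCdot (T.not_le_PiCdot_of_mem_four hZ)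

/-- `[Γ(Π^tp_Z) : Π^tp_Ż] = 2` for an automorphism `Γ` of `Π^tp_C` stabilising `Π^tp_Ż` (index bookkeeping:
`[Π^tp_C : Γ(Π^tp_Z)] = [Π^tp_C : Π^tp_Z]` and `[Π^tp_C : Π^tp_Ż] = 2·[Π^tp_C : Π^tp_Z]`).
[cite: MochizukiEtTh2009, Def 2.5 (ii) p.39] -/
theorem relIndex_inf_PiCdot_map_of_mem_four (Γ : T.Gtp ≃ₜ* T.Gtp) {Z : Subgroup T.Gtp}
    (hZ : Z ∈ [T.tp T.PiXuu, T.tp T.PiXu, T.tp T.PiCuu, T.tp T.PiCu])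
    (hΓ : (Z ⊓ T.PiCdot).map Γ.toMulEquiv.toMonoidHom = Z ⊓ T.PiCdot) :
    (Z ⊓ T.PiCdot).relIndex (Z.map Γ.toMulEquiv.toMonoidHom) = 2 := by
  haveI := T.finiteIndex_of_mem_four hZ
  have hle : Z ⊓ T.PiCdot ≤ Z.map Γ.toMulEquiv.toMonoidHom := by
    conv_lhs => rw [← hΓ]
    exact Subgroup.map_mono inf_le_left
  have h := Subgroup.relIndex_mul_index hle
  have hidx : (Z.map Γ.toMulEquiv.toMonoidHom).index = Z.index :=
    Subgroup.index_map_of_bijective (f := Γ.toMulEquiv.toMonoidHom) Γ.toMulEquiv.bijective _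
  rw [hidx, T.index_inf_PiCdot_of_mem_four hZ] at h
  have hZ0 : 0 < Z.index := Nat.pos_of_ne_zero Subgroup.FiniteIndex.index_ne_zero
  have h' : (Z ⊓ T.PiCdot).relIndex (Z.map Γ.toMulEquiv.toMonoidHom) * Z.index = 2 * Z.index := by
    rw [h]; ring
  exact Nat.eq_of_mul_eq_mul_right hZ0 h'

/-! ### The derived `Z`-stabilisations, for ANY topological automorphism `Γ` of `Π^tp_C` -/

variable {T}

/-- **`C̲` from `Ċ̲`** (no hypothesis): an automorphism of `Π^tp_C` stabilising `Π^tp_{Ċ̲} = Π^tp_{C̲} ∩ Π^tp_Ċ`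
stabilises `Π^tp_{C̲}`, since `N(Π^tp_{Ċ̲}) = N(Π^tp_{C̲}) = Π^tp_{C̲}` (abc-iut-L2-t12 `normalizer_tpPiCu_inf_PiCdot_eq`,
Rmk. 2.1.1). [cite: MochizukiEtTh2009, Rmk 2.6.1 p.40] -/
theorem map_tp_PiCu_eq_of_map_inf_PiCdot_PiCu (Γ : T.Gtp ≃ₜ* T.Gtp)
    (h : (T.tp T.PiCu ⊓ T.PiCdot).map Γ.toMulEquiv.toMonoidHom = T.tp T.PiCu ⊓ T.PiCdot) :
    (T.tp T.PiCu).map Γ.toMulEquiv.toMonoidHom = T.tp T.PiCu := by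
  have e := Subgroup.map_equiv_normalizer_eq (T.tp T.PiCu ⊓ T.PiCdot) Γ.toMulEquiv
  rw [h, T.normalizer_tpPiCu_inf_PiCdot_eq, T.normalizer_tpPiCu_eq] at e
  exact e

/-- **`C̲` from `Ċ̲̲`** under `μ_l ⊆ K`: an automorphism of `Π^tp_C` stabilising `Π^tp_{Ċ̲̲}` stabilises
`N(Π^tp_{Ċ̲̲}) = N(Π^tp_{C̲̲}) = Π^tp_{C̲}` (abc-iut-L2-t12 `normalizer_tpPiCuu_inf_PiCdot_eq`, abc-iut-L6-t23
`normalizer_tpPiCuu_eq`). [cite: MochizukiEtTh2009, Rmk 2.6.1 p.40] -/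
theorem map_tp_PiCu_eq_of_map_inf_PiCdot_PiCuu (hmu : T.HasMuL) (Γ : T.Gtp ≃ₜ* T.Gtp)
    (h : (T.tp T.PiCuu ⊓ T.PiCdot).map Γ.toMulEquiv.toMonoidHom = T.tp T.PiCuu ⊓ T.PiCdot) :
    (T.tp T.PiCu).map Γ.toMulEquiv.toMonoidHom = T.tp T.PiCu := by
  have e := Subgroup.map_equiv_normalizer_eq (T.tp T.PiCuu ⊓ T.PiCdot) Γ.toMulEquiv
  rw [h, T.normalizer_tpPiCuu_inf_PiCdot_eq hmu, T.normalizer_tpPiCuu_eq hmu] at e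
  exact e

/-- **`C̲̲` from `Ċ̲̲`** under `μ_l ⊆ K`: an automorphism `Γ` of `Π^tp_C` stabilising `Π^tp_{Ċ̲̲}` stabilises
`Π^tp_{C̲̲}` — `Γ(Π^tp_{C̲̲})` and `Π^tp_{C̲̲}` are index-`2` overgroups of `Π^tp_{Ċ̲̲}` inside `Π^tp_{C̲} = N(Π^tp_{C̲̲})`, of
odd index `l` there (`Subgroup.eq_of_relIndex_two_of_odd_relIndex`). [cite: MochizukiEtTh2009, Rmk 2.6.1 p.40] -/
theorem map_tp_PiCuu_eq_of_map_inf_PiCdot_PiCuu (hmu : T.HasMuL) (Γ : T.Gtp ≃ₜ* T.Gtp)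
    (h : (T.tp T.PiCuu ⊓ T.PiCdot).map Γ.toMulEquiv.toMonoidHom = T.tp T.PiCuu ⊓ T.PiCdot) :
    (T.tp T.PiCuu).map Γ.toMulEquiv.toMonoidHom = T.tp T.PiCuu := by
  have hmem : T.tp T.PiCuu ∈ [T.tp T.PiXuu, T.tp T.PiXu, T.tp T.PiCuu, T.tp T.PiCu] := by simp
  have hCu := map_tp_PiCu_eq_of_map_inf_PiCdot_PiCuu hmu Γ h
  have hAM : T.tp T.PiCuu ⊓ T.PiCdot ≤ (T.tp T.PiCuu).map Γ.toMulEquiv.toMonoidHom := by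
    conv_lhs => rw [← h]
    exact Subgroup.map_mono inf_le_left
  have hMB : (T.tp T.PiCuu).map Γ.toMulEquiv.toMonoidHom ≤ T.tp T.PiCu := by
    conv_rhs => rw [← hCu]
    exact Subgroup.map_mono T.tp_PiCuu_le_tp_PiCu''
  refine Subgroup.eq_of_relIndex_two_of_odd_relIndex hAM inf_le_left hMB T.tp_PiCuu_le_tp_PiCu''
    (T.normalizer_tpPiCuu_eq hmu).ge (T.relIndex_inf_PiCdot_map_of_mem_four Γ hmem h)
    (T.relIndex_inf_PiCdot_of_mem_four hmem) ?_
  rw [T.relIndex_tp_PiCuu_tp_PiCu]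
  exact T.l_odd

/-- **`C̲` from `Ẋ̲̲`** under `μ_l ⊆ K` and the printed definition `hΘ` of `Δ̄_Θ`: an automorphism of `Π^tp_C`
stabilising `Π^tp_{Ẋ̲̲}` stabilises `N(Π^tp_{Ẋ̲̲}) = N(Π^tp_{X̲̲}) = Π^tp_{C̲}` (abc-iut-L2-t12
`normalizer_tpPiXuu_inf_PiCdot_eq`, `normalizer_tpPiXuu_eq`). [cite: MochizukiEtTh2009, Rmk 2.6.1 p.40] -/
theorem map_tp_PiCu_eq_of_map_inf_PiCdot_PiXuu (hΘ : ⁅T.DeltaX, T.DeltaX⁆ ⊔ T.barKer = T.barTheta)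
    (hmu : T.HasMuL) (Γ : T.Gtp ≃ₜ* T.Gtp)
    (h : (T.tp T.PiXuu ⊓ T.PiCdot).map Γ.toMulEquiv.toMonoidHom = T.tp T.PiXuu ⊓ T.PiCdot) :
    (T.tp T.PiCu).map Γ.toMulEquiv.toMonoidHom = T.tp T.PiCu := by
  have e := Subgroup.map_equiv_normalizer_eq (T.tp T.PiXuu ⊓ T.PiCdot) Γ.toMulEquiv
  rw [h, T.normalizer_tpPiXuu_inf_PiCdot_eq hΘ hmu, T.normalizer_tpPiXuu_eq hΘ hmu] at e
  exact e

/-- **`X̲̲` from `Ẋ̲̲`** under `μ_l ⊆ K`, `hΘ` and `l ≠ 1`: an automorphism `Γ` of `Π^tp_C` stabilising `Π^tp_{Ẋ̲̲}`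
stabilises `Π^tp_{C̲}` (normaliser), hence its normal core `Π^tp_{X̲}`, and `Γ(Π^tp_{X̲̲})`, `Π^tp_{X̲̲}` are index-`2`
overgroups of `Π^tp_{Ẋ̲̲}` inside `Π^tp_{X̲} ≤ N(Π^tp_{X̲̲})`, of odd index `l` there. [cite: MochizukiEtTh2009, Rmk 2.6.1 p.40] -/
theorem map_tp_PiXuu_eq_of_map_inf_PiCdot_PiXuu (hΘ : ⁅T.DeltaX, T.DeltaX⁆ ⊔ T.barKer = T.barTheta)
    (hmu : T.HasMuL) (hl : l ≠ 1) (Γ : T.Gtp ≃ₜ* T.Gtp)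
    (h : (T.tp T.PiXuu ⊓ T.PiCdot).map Γ.toMulEquiv.toMonoidHom = T.tp T.PiXuu ⊓ T.PiCdot) :
    (T.tp T.PiXuu).map Γ.toMulEquiv.toMonoidHom = T.tp T.PiXuu := by
  have hmem : T.tp T.PiXuu ∈ [T.tp T.PiXuu, T.tp T.PiXu, T.tp T.PiCuu, T.tp T.PiCu] := by simp
  have hCu := map_tp_PiCu_eq_of_map_inf_PiCdot_PiXuu hΘ hmu Γ h
  have hXu := map_tp_PiXu_eq_of_map_tp_PiCu hl Γ hCu
  have hAM : T.tp T.PiXuu ⊓ T.PiCdot ≤ (T.tp T.PiXuu).map Γ.toMulEquiv.toMonoidHom := by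
    conv_lhs => rw [← h]
    exact Subgroup.map_mono inf_le_left
  have hMB : (T.tp T.PiXuu).map Γ.toMulEquiv.toMonoidHom ≤ T.tp T.PiXu := by
    conv_rhs => rw [← hXu]
    exact Subgroup.map_mono T.tp_PiXuu_le_tp_PiXu
  have hBC : T.tp T.PiXu ≤ Subgroup.normalizer ((T.tp T.PiXuu : Subgroup T.Gtp) : Set T.Gtp) := by
    rw [T.normalizer_tpPiXuu_eq hΘ hmu]
    exact T.tp_PiXu_le_tp_PiCu
  refine Subgroup.eq_of_relIndex_two_of_odd_relIndex hAM inf_le_left hMB T.tp_PiXuu_le_tp_PiXu hBC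
    (T.relIndex_inf_PiCdot_map_of_mem_four Γ hmem h) (T.relIndex_inf_PiCdot_of_mem_four hmem) ?_
  rw [T.relIndex_tp_PiXuu_tp_PiXu]
  exact T.l_odd

/-- **`Π^tp_{X̲}` is cut out by its dotted version**: for `l ≠ 1`, `g ∈ Π^tp_{X̲}` iff EVERY commutator `g h g⁻¹ h⁻¹`
(`h ∈ Π^tp_C`) lies in `Π^tp_{Ẋ̲} = Π^tp_{X̲} ∩ Π^tp_Ċ` — i.e. `Π^tp_{X̲}/Π^tp_{Ẋ̲}` is the centre of `Π^tp_C/Π^tp_{Ẋ̲}`: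
`Π^tp_{X̲} ⊴ Π^tp_C` with `Π^tp_C/Π^tp_{X̲} ≅ D_l` (Rmk. 2.6.1 `Aut_K(X̲) = ℤ/lℤ ⋊ {±1}`, abc-iut-L6-t23) centreless for
`l` odd `≠ 1`, and commutators die in `Π^tp_C/Π^tp_Ċ ≅ ℤ/2`. [cite: MochizukiEtTh2009, Rmk 2.6.1 p.40] -/
theorem mem_tp_PiXu_iff_forall_commutator_mem (hl : l ≠ 1) (g : T.Gtp) :
    g ∈ T.tp T.PiXu ↔ ∀ h : T.Gtp, g * h * g⁻¹ * h⁻¹ ∈ T.tp T.PiXu ⊓ T.PiCdot := by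
  haveI hXu : (T.tp T.PiXu).Normal := T.tpPiXu_normal
  haveI hD : T.PiCdot.Normal := Subgroup.normal_of_index_eq_two T.index_PiCdot
  constructor
  · intro hg h
    rw [Subgroup.mem_inf]
    refine ⟨?_, ?_⟩
    · have h1 : h * g⁻¹ * h⁻¹ ∈ T.tp T.PiXu := hXu.conj_mem _ (inv_mem hg) h
      have e1 : g * h * g⁻¹ * h⁻¹ = g * (h * g⁻¹ * h⁻¹) := by group
      rw [e1]
      exact mul_mem hg h1
    · -- every commutator lies in the index-`2` subgroup `Π^tp_Ċ`
      have h2 := T.index_PiCdot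
      have hconj : g * h * g⁻¹ ∈ T.PiCdot ↔ h ∈ T.PiCdot :=
        ⟨fun hh => by
          have h3 := hD.conj_mem _ hh g⁻¹
          rwa [show g⁻¹ * (g * h * g⁻¹) * g⁻¹⁻¹ = h by group] at h3,
         fun hh => hD.conj_mem _ hh g⟩
      rw [Subgroup.mul_mem_iff_of_index_two h2, hconj, inv_mem_iff]
  · intro hg
    set N := Subgroup.normalizer ((T.tp T.PiXu : Subgroup T.Gtp) : Set T.Gtp) with hNdef
    have hN : N = ⊤ := Subgroup.normalizer_eq_top _
    have hmemN : ∀ x : T.Gtp, x ∈ N := fun x => by rw [hN]; exact Subgroup.mem_top x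
    obtain ⟨e⟩ := T.nonempty_autK_tpPiXu_mulEquiv_dihedralGroup
    -- the class of `g` in `Π^tp_C/Π^tp_{X̲}` is central …
    have hq : e (QuotientGroup.mk ⟨g, hmemN g⟩ : T.autK (T.tp T.PiXu)) ∈
        Subgroup.center (DihedralGroup l) := by
      rw [Subgroup.mem_center_iff]
      intro d
      obtain ⟨q', rfl⟩ := e.surjective d
      rw [← map_mul, ← map_mul]
      congr 1
      induction q' using QuotientGroup.induction_on with
      | H x =>
        rw [← QuotientGroup.mk_mul, ← QuotientGroup.mk_mul, QuotientGroup.eq, Subgroup.mem_subgroupOf]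
        change ((x : T.Gtp) * g)⁻¹ * (g * (x : T.Gtp)) ∈ T.tp T.PiXu
        have e1 : ((x : T.Gtp) * g)⁻¹ * (g * (x : T.Gtp)) =
            ((x : T.Gtp) * g)⁻¹ * (g * (x : T.Gtp) * g⁻¹ * (x : T.Gtp)⁻¹) * ((x : T.Gtp) * g) := by
          group
        rw [e1]
        exact hXu.conj_mem' _ (hg x).1 _
    -- … and the centre of `D_l` is trivial (`l` odd, `l ≠ 1`)
    rw [DihedralGroup.center_eq_bot_of_odd_ne_one T.l_odd hl, Subgroup.mem_bot, MulEquiv.map_eq_one_iff,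
      QuotientGroup.eq_one_iff, Subgroup.mem_subgroupOf] at hq
    exact hq

/-- **`X̲` from `Ẋ̲`** (`l ≠ 1`, no further hypothesis): an automorphism of `Π^tp_C` stabilising `Π^tp_{Ẋ̲}` stabilises
`Π^tp_{X̲}` (the centre of `Π^tp_C/Π^tp_{Ẋ̲}`). [cite: MochizukiEtTh2009, Rmk 2.6.1 p.40] -/
theorem map_tp_PiXu_eq_of_map_inf_PiCdot_PiXu (hl : l ≠ 1) (Γ : T.Gtp ≃ₜ* T.Gtp)
    (h : (T.tp T.PiXu ⊓ T.PiCdot).map Γ.toMulEquiv.toMonoidHom = T.tp T.PiXu ⊓ T.PiCdot) :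
    (T.tp T.PiXu).map Γ.toMulEquiv.toMonoidHom = T.tp T.PiXu :=
  Subgroup.map_eq_of_mem_iff_forall_commutator_mem (mem_tp_PiXu_iff_forall_commutator_mem hl) Γ.toMulEquiv h

/-! ### `Prop26` ⟺ «extension (stabilising `Π^tp_Ċ` for the `X`-members)» -/

/-- **Prop. 2.6 from the bare extensions** (`μ_l ⊆ K`, `hΘ`, `l ≠ 1`): if every topological automorphism of
`Π^tp_{Ċ̲}` and of `Π^tp_{Ċ̲̲}` extends to a topological automorphism of `Π^tp_C`, and every topological automorphism
of `Π^tp_{Ẋ̲̲}` and of `Π^tp_{Ẋ̲}` extends to one stabilising `Π^tp_Ċ`, then the typed `Prop26` holds — the `Ż`-clause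
is automatic (w6-d084), the `Z`-clauses are the four theorems above, the `Ċ`-clause is automatic for `Ċ̲`, `Ċ̲̲`
(w6-d084 `map_PiCdot_eq_of_map_inf_PiCdot_eq`).  The hypothesis is the absolute-anabelian content of the printed
proof («entirely similar to the proofs of Propositions 1.8, 2.4»: the `K`-core, [Mzk3] Thm. 2.4; the double covering
`Ċ`, Def. 1.7) and is NOT proved here. [cite: MochizukiEtTh2009, Prop 2.6 p.40] -/
theorem prop26_of_extends (hΘ : ⁅T.DeltaX, T.DeltaX⁆ ⊔ T.barKer = T.barTheta) (hmu : T.HasMuL) (hl : l ≠ 1)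
    (hXuu : ∀ γ : ↥(T.tp T.PiXuu ⊓ T.PiCdot) ≃ₜ* ↥(T.tp T.PiXuu ⊓ T.PiCdot),
      ∃ Γ : T.Gtp ≃ₜ* T.Gtp, (∀ x : ↥(T.tp T.PiXuu ⊓ T.PiCdot), Γ x = γ x) ∧
        T.PiCdot.map Γ.toMulEquiv.toMonoidHom = T.PiCdot)
    (hXu : ∀ γ : ↥(T.tp T.PiXu ⊓ T.PiCdot) ≃ₜ* ↥(T.tp T.PiXu ⊓ T.PiCdot),
      ∃ Γ : T.Gtp ≃ₜ* T.Gtp, (∀ x : ↥(T.tp T.PiXu ⊓ T.PiCdot), Γ x = γ x) ∧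
        T.PiCdot.map Γ.toMulEquiv.toMonoidHom = T.PiCdot)
    (hCuu : ∀ γ : ↥(T.tp T.PiCuu ⊓ T.PiCdot) ≃ₜ* ↥(T.tp T.PiCuu ⊓ T.PiCdot),
      ∃ Γ : T.Gtp ≃ₜ* T.Gtp, ∀ x : ↥(T.tp T.PiCuu ⊓ T.PiCdot), Γ x = γ x)
    (hCu : ∀ γ : ↥(T.tp T.PiCu ⊓ T.PiCdot) ≃ₜ* ↥(T.tp T.PiCu ⊓ T.PiCdot),
      ∃ Γ : T.Gtp ≃ₜ* T.Gtp, ∀ x : ↥(T.tp T.PiCu ⊓ T.PiCdot), Γ x = γ x) :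
    T.Prop26 := by
  refine T.prop26_of_core (fun Z hZ => ?_) (fun Z hZ => ?_)
  · simp only [List.mem_cons, List.mem_nil_iff, or_false] at hZ
    rcases hZ with rfl | rfl
    · intro γ
      obtain ⟨Γ, hΓ, hC⟩ := hXuu γ
      have hZ : (T.tp T.PiXuu ⊓ T.PiCdot).map Γ.toMulEquiv.toMonoidHom = T.tp T.PiXuu ⊓ T.PiCdot :=
        map_eq_self_of_restricts Γ.toMulEquiv γ.toMulEquiv hΓ
      exact ⟨Γ, hΓ, map_tp_PiXuu_eq_of_map_inf_PiCdot_PiXuu hΘ hmu hl Γ hZ, hC⟩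
    · intro γ
      obtain ⟨Γ, hΓ, hC⟩ := hXu γ
      have hZ : (T.tp T.PiXu ⊓ T.PiCdot).map Γ.toMulEquiv.toMonoidHom = T.tp T.PiXu ⊓ T.PiCdot :=
        map_eq_self_of_restricts Γ.toMulEquiv γ.toMulEquiv hΓ
      exact ⟨Γ, hΓ, map_tp_PiXu_eq_of_map_inf_PiCdot_PiXu hl Γ hZ, hC⟩
  · simp only [List.mem_cons, List.mem_nil_iff, or_false] at hZ
    rcases hZ with rfl | rfl
    · intro γ
      obtain ⟨Γ, hΓ⟩ := hCuu γ
      have hZ : (T.tp T.PiCuu ⊓ T.PiCdot).map Γ.toMulEquiv.toMonoidHom = T.tp T.PiCuu ⊓ T.PiCdot :=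
        map_eq_self_of_restricts Γ.toMulEquiv γ.toMulEquiv hΓ
      exact ⟨Γ, hΓ, map_tp_PiCuu_eq_of_map_inf_PiCdot_PiCuu hmu Γ hZ⟩
    · intro γ
      obtain ⟨Γ, hΓ⟩ := hCu γ
      have hZ : (T.tp T.PiCu ⊓ T.PiCdot).map Γ.toMulEquiv.toMonoidHom = T.tp T.PiCu ⊓ T.PiCdot :=
        map_eq_self_of_restricts Γ.toMulEquiv γ.toMulEquiv hΓ
      exact ⟨Γ, hΓ, map_tp_PiCu_eq_of_map_inf_PiCdot_PiCu Γ hZ⟩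

/-- Conversely the typed `Prop26` contains the bare extensions (projection; no hypothesis).
[cite: MochizukiEtTh2009, Prop 2.6 p.40] -/
theorem extends_of_prop26 (h : T.Prop26) :
    (∀ γ : ↥(T.tp T.PiXuu ⊓ T.PiCdot) ≃ₜ* ↥(T.tp T.PiXuu ⊓ T.PiCdot),
      ∃ Γ : T.Gtp ≃ₜ* T.Gtp, (∀ x : ↥(T.tp T.PiXuu ⊓ T.PiCdot), Γ x = γ x) ∧
        T.PiCdot.map Γ.toMulEquiv.toMonoidHom = T.PiCdot) ∧
    (∀ γ : ↥(T.tp T.PiXu ⊓ T.PiCdot) ≃ₜ* ↥(T.tp T.PiXu ⊓ T.PiCdot),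
      ∃ Γ : T.Gtp ≃ₜ* T.Gtp, (∀ x : ↥(T.tp T.PiXu ⊓ T.PiCdot), Γ x = γ x) ∧
        T.PiCdot.map Γ.toMulEquiv.toMonoidHom = T.PiCdot) ∧
    (∀ γ : ↥(T.tp T.PiCuu ⊓ T.PiCdot) ≃ₜ* ↥(T.tp T.PiCuu ⊓ T.PiCdot),
      ∃ Γ : T.Gtp ≃ₜ* T.Gtp, ∀ x : ↥(T.tp T.PiCuu ⊓ T.PiCdot), Γ x = γ x) ∧
    (∀ γ : ↥(T.tp T.PiCu ⊓ T.PiCdot) ≃ₜ* ↥(T.tp T.PiCu ⊓ T.PiCdot),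
      ∃ Γ : T.Gtp ≃ₜ* T.Gtp, ∀ x : ↥(T.tp T.PiCu ⊓ T.PiCdot), Γ x = γ x) := by
  refine ⟨fun γ => ?_, fun γ => ?_, fun γ => ?_, fun γ => ?_⟩
  · obtain ⟨Γ, hΓ, -, hC⟩ := T.core_of_prop26 h (Z := T.tp T.PiXuu) (by simp) γ
    exact ⟨Γ, hΓ, hC⟩
  · obtain ⟨Γ, hΓ, -, hC⟩ := T.core_of_prop26 h (Z := T.tp T.PiXu) (by simp) γ
    exact ⟨Γ, hΓ, hC⟩
  · obtain ⟨Γ, hΓ, -, -⟩ := T.core_of_prop26 h (Z := T.tp T.PiCuu) (by simp) γ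
    exact ⟨Γ, hΓ⟩
  · obtain ⟨Γ, hΓ, -, -⟩ := T.core_of_prop26 h (Z := T.tp T.PiCu) (by simp) γ
    exact ⟨Γ, hΓ⟩

/-- **`Prop26` is EQUIVALENT over the interface to the bare extensions** — for `l ≠ 1`, under `μ_l ⊆ K`
(`T.HasMuL`, the standing hypothesis of Rmk. 2.6.1 / Cor. 2.9) and the printed definition `hΘ` of `Δ̄_Θ`: for `Ċ̲`
and `Ċ̲̲` the typed clause IS the `K`-core extension property and nothing else; for `Ẋ̲̲` and `Ẋ̲` it is the extension
stabilising `Π^tp_Ċ`.  WHAT PRINT'S HYPOTHESES LEAVE TO PROVE at a datum where Prop. 2.6 holds is exactly this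
right-hand side. [cite: MochizukiEtTh2009, Prop 2.6 p.40] -/
theorem prop26_iff_extends (hΘ : ⁅T.DeltaX, T.DeltaX⁆ ⊔ T.barKer = T.barTheta) (hmu : T.HasMuL) (hl : l ≠ 1) :
    T.Prop26 ↔
      ((∀ γ : ↥(T.tp T.PiXuu ⊓ T.PiCdot) ≃ₜ* ↥(T.tp T.PiXuu ⊓ T.PiCdot),
        ∃ Γ : T.Gtp ≃ₜ* T.Gtp, (∀ x : ↥(T.tp T.PiXuu ⊓ T.PiCdot), Γ x = γ x) ∧
          T.PiCdot.map Γ.toMulEquiv.toMonoidHom = T.PiCdot) ∧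
      (∀ γ : ↥(T.tp T.PiXu ⊓ T.PiCdot) ≃ₜ* ↥(T.tp T.PiXu ⊓ T.PiCdot),
        ∃ Γ : T.Gtp ≃ₜ* T.Gtp, (∀ x : ↥(T.tp T.PiXu ⊓ T.PiCdot), Γ x = γ x) ∧
          T.PiCdot.map Γ.toMulEquiv.toMonoidHom = T.PiCdot) ∧
      (∀ γ : ↥(T.tp T.PiCuu ⊓ T.PiCdot) ≃ₜ* ↥(T.tp T.PiCuu ⊓ T.PiCdot),
        ∃ Γ : T.Gtp ≃ₜ* T.Gtp, ∀ x : ↥(T.tp T.PiCuu ⊓ T.PiCdot), Γ x = γ x) ∧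
      (∀ γ : ↥(T.tp T.PiCu ⊓ T.PiCdot) ≃ₜ* ↥(T.tp T.PiCu ⊓ T.PiCdot),
        ∃ Γ : T.Gtp ≃ₜ* T.Gtp, ∀ x : ↥(T.tp T.PiCu ⊓ T.PiCdot), Γ x = γ x)) :=
  ⟨extends_of_prop26, fun h => prop26_of_extends hΘ hmu hl h.1 h.2.1 h.2.2.1 h.2.2.2⟩

/-- The same equivalence with the printed definition of `Δ̄_Θ` in abc-iut-L2-t2's predicate currency
`CoverData.IsCommutatorTheta` (`ThetaCoversCommutatorTheta.lean`). [cite: MochizukiEtTh2009, Prop 2.6 p.40] -/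
theorem prop26_iff_extends_of_isCommutatorTheta (hΘ : T.toCoverData.IsCommutatorTheta) (hmu : T.HasMuL)
    (hl : l ≠ 1) :
    T.Prop26 ↔
      ((∀ γ : ↥(T.tp T.PiXuu ⊓ T.PiCdot) ≃ₜ* ↥(T.tp T.PiXuu ⊓ T.PiCdot),
        ∃ Γ : T.Gtp ≃ₜ* T.Gtp, (∀ x : ↥(T.tp T.PiXuu ⊓ T.PiCdot), Γ x = γ x) ∧
          T.PiCdot.map Γ.toMulEquiv.toMonoidHom = T.PiCdot) ∧
      (∀ γ : ↥(T.tp T.PiXu ⊓ T.PiCdot) ≃ₜ* ↥(T.tp T.PiXu ⊓ T.PiCdot),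
        ∃ Γ : T.Gtp ≃ₜ* T.Gtp, (∀ x : ↥(T.tp T.PiXu ⊓ T.PiCdot), Γ x = γ x) ∧
          T.PiCdot.map Γ.toMulEquiv.toMonoidHom = T.PiCdot) ∧
      (∀ γ : ↥(T.tp T.PiCuu ⊓ T.PiCdot) ≃ₜ* ↥(T.tp T.PiCuu ⊓ T.PiCdot),
        ∃ Γ : T.Gtp ≃ₜ* T.Gtp, ∀ x : ↥(T.tp T.PiCuu ⊓ T.PiCdot), Γ x = γ x) ∧
      (∀ γ : ↥(T.tp T.PiCu ⊓ T.PiCdot) ≃ₜ* ↥(T.tp T.PiCu ⊓ T.PiCdot),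
        ∃ Γ : T.Gtp ≃ₜ* T.Gtp, ∀ x : ↥(T.tp T.PiCu ⊓ T.PiCdot), Γ x = γ x)) :=
  prop26_iff_extends hΘ.commutator_sup_barKer hmu hl

end TemperedCoverData

end ThetaCovers

end Literature.AnabelianGeometry.EtaleTheta
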